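import Mathlib.Analysis.Complex.Convex
import Mathlib.Analysis.Normed.Module.Convex
import Mathlib.Topology.MetricSpace.HausdorffDistance
import Mathlib.Analysis.Complex.UpperHalfPlane.Topology
import HarnessLib

/-!
# `δ`-clusters of a compact plane set and their half-plane neighbourhoods

Topic `Probability/RandomPlanarGeometry`; definitions + theorems (pure metric topology). For a set
`A ⊆ ℂ` and `δ > 0`, two points of `A` are `δ`-linked if they are joined by a finite chain of points
of `A` with consecutive distances `< 2δ`; the classes are the **`δ`-clusters** `deltaCluster A δ a`.
For compact `A` they are finitely many closed, relatively clopen pieces of `A`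
(`finite_setOf_deltaCluster`, `isClosed_deltaCluster`, `isClosed_diff_deltaCluster`). The
**cluster neighbourhood** `deltaClusterNhd A δ a = {z : 0 ≤ Im z, dist (z, cluster) < δ}` is a
connected relatively open subset of the closed half-plane; distinct clusters have disjoint
neighbourhoods, and `{z : 0 ≤ Im z, infDist z A < δ}` is their union.

Use (locality of SLE₆ with respect to a hull `A`, Lawler–Schramm–Werner (2001) Thm. 2.2 /
Lawler (2005) Thm. 6.13, neighbourhood form `sle_six_hull_locality_nbhd`): when the stopping set
contains the `δ`-neighbourhood of `A`, a loop of the SLE₆ trace closed before the stopping time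
avoids every cluster neighbourhood, so the Loewner hull swallows whole clusters, finitely many
times; the part of `A` not yet swallowed is a clopen piece of `A` (a `*`-hull,
`StarHullClopenPiece`).

## References

* G. F. Lawler, *Conformally Invariant Processes in the Plane* (2005), §6.3 Thm. 6.13. [Lawler2005]
* G. F. Lawler, O. Schramm, W. Werner, Acta Math. 187 (2001), Thm. 2.2. [LawlerSchrammWerner2001]
-/

noncomputable section

open Set Filter Topology Metric Bornology Complex Relation
open UpperHalfPlane (upperHalfPlaneSet isOpen_upperHalfPlaneSet)

namespace Literature.Probability.RandomPlanarGeometry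

variable {A : Set ℂ} {δ : ℝ} {a b c z : ℂ}

/-! ### `δ`-steps and `δ`-clusters -/

/-- One `δ`-step inside `A`: both points in `A`, at distance `< 2δ` (so that the `δ`-balls about
them meet). [folklore] -/
def deltaStep (A : Set ℂ) (δ : ℝ) (x y : ℂ) : Prop :=
  x ∈ A ∧ y ∈ A ∧ dist x y < 2 * δ

/-- The **`δ`-cluster** of `a` in `A`: the points reachable from `a` by finite chains of `δ`-steps
inside `A` (for `a ∉ A` the junk value `{a}`). [folklore] -/
def deltaCluster (A : Set ℂ) (δ : ℝ) (a : ℂ) : Set ℂ :=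
  {b | ReflTransGen (deltaStep A δ) a b}

/-- `δ`-steps are symmetric. [folklore] -/
theorem deltaStep_symm {x y : ℂ} (h : deltaStep A δ x y) : deltaStep A δ y x :=
  ⟨h.2.1, h.1, by rw [dist_comm]; exact h.2.2⟩

/-- Chains of `δ`-steps can be reversed. [folklore] -/
theorem reflTransGen_deltaStep_symm {x y : ℂ} (h : ReflTransGen (deltaStep A δ) x y) :
    ReflTransGen (deltaStep A δ) y x := by
  induction h with
  | refl => exact ReflTransGen.refl
  | tail _ hbc ih => exact ReflTransGen.head (deltaStep_symm hbc) ih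

/-- `a` is in its own cluster. [folklore] -/
theorem mem_deltaCluster_self (A : Set ℂ) (δ : ℝ) (a : ℂ) : a ∈ deltaCluster A δ a :=
  ReflTransGen.refl

/-- Unfolding of membership in a cluster. [folklore] -/
theorem mem_deltaCluster_iff : b ∈ deltaCluster A δ a ↔ ReflTransGen (deltaStep A δ) a b := Iff.rfl

/-- The cluster of a point of `A` lies in `A`. [folklore] -/
theorem deltaCluster_subset (ha : a ∈ A) : deltaCluster A δ a ⊆ A := by
  intro b hb
  induction hb with
  | refl => exact ha
  | tail _ h _ => exact h.2.1

/-- Clusters are closed under `δ`-steps: a point of `A` within `2δ` of a point of the cluster of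
`a ∈ A` belongs to that cluster. [folklore] -/
theorem mem_deltaCluster_of_dist_lt (ha : a ∈ A) (hc : c ∈ deltaCluster A δ a) (hb : b ∈ A)
    (hd : dist c b < 2 * δ) : b ∈ deltaCluster A δ a :=
  ReflTransGen.tail hc ⟨deltaCluster_subset ha hc, hb, hd⟩

/-- **Clusters through a common point coincide** (the linking relation is an equivalence). [folklore] -/
theorem deltaCluster_eq_of_mem (h : b ∈ deltaCluster A δ a) : deltaCluster A δ b = deltaCluster A δ a := by
  have h' : ReflTransGen (deltaStep A δ) b a := reflTransGen_deltaStep_symm h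
  ext c
  exact ⟨fun hc ↦ ReflTransGen.trans h hc, fun hc ↦ ReflTransGen.trans h' hc⟩

/-- Two clusters of points of `A` that come within `2δ` of each other coincide. [folklore] -/
theorem deltaCluster_eq_of_dist_lt (ha : a ∈ A) (hb : b ∈ A) {x y : ℂ} (hx : x ∈ deltaCluster A δ a)
    (hy : y ∈ deltaCluster A δ b) (hd : dist x y < 2 * δ) : deltaCluster A δ a = deltaCluster A δ b := by
  have hyA : y ∈ A := deltaCluster_subset hb hy
  have hya : y ∈ deltaCluster A δ a := mem_deltaCluster_of_dist_lt ha hx hyA hd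
  rw [← deltaCluster_eq_of_mem hya, deltaCluster_eq_of_mem hy]

/-- **Clusters are closed** (for closed `A` and `δ > 0`): a limit of cluster points is a point of
`A` within `2δ` of the cluster. [folklore] -/
theorem isClosed_deltaCluster (hA : IsClosed A) (hδ : 0 < δ) (ha : a ∈ A) :
    IsClosed (deltaCluster A δ a) := by
  refine isClosed_of_closure_subset fun b hb ↦ ?_
  have hbA : b ∈ A := closure_minimal (deltaCluster_subset ha) hA hb
  obtain ⟨c, hc, hcb⟩ := Metric.mem_closure_iff.1 hb (2 * δ) (by positivity)
  exact mem_deltaCluster_of_dist_lt ha hc hbA (by rw [dist_comm]; exact hcb)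

/-- **The rest of `A` is closed too**: clusters are relatively open in `A`. [folklore] -/
theorem isClosed_diff_deltaCluster (hA : IsClosed A) (hδ : 0 < δ) (ha : a ∈ A) :
    IsClosed (A \ deltaCluster A δ a) := by
  refine isClosed_of_closure_subset fun b hb ↦ ?_
  have hbA : b ∈ A := closure_minimal sdiff_subset hA hb
  refine ⟨hbA, fun hba ↦ ?_⟩
  obtain ⟨c, hc, hcb⟩ := Metric.mem_closure_iff.1 hb (2 * δ) (by positivity)
  exact hc.2 (mem_deltaCluster_of_dist_lt ha hba hc.1 hcb)

/-- **A compact set has finitely many `δ`-clusters**: cover `A` by finitely many `δ`-balls centred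
in `A`; every cluster is the cluster of one of the centres. [folklore] -/
theorem finite_setOf_deltaCluster (hA : IsCompact A) (hδ : 0 < δ) :
    {C : Set ℂ | ∃ a ∈ A, C = deltaCluster A δ a}.Finite := by
  obtain ⟨t, htA, htfin, hcover⟩ := finite_cover_balls_of_compact hA hδ
  refine (htfin.image fun x ↦ deltaCluster A δ x).subset ?_
  rintro C ⟨a, ha, rfl⟩
  obtain ⟨x, hxt, hax⟩ := mem_iUnion₂.1 (hcover ha)
  refine ⟨x, hxt, (deltaCluster_eq_of_mem (a := x) (b := a) ?_).symm⟩
  refine mem_deltaCluster_of_dist_lt (htA hxt) (mem_deltaCluster_self A δ x) ha ?_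
  rw [dist_comm]
  have : dist a x < δ := hax
  linarith

/-! ### Cluster neighbourhoods in the closed half-plane -/

/-- The **cluster neighbourhood** `{z : 0 ≤ Im z, dist (z, cluster of a) < δ}`: the union of the
half-balls `ball c δ ∩ {Im ≥ 0}` over the cluster. [folklore] -/
def deltaClusterNhd (A : Set ℂ) (δ : ℝ) (a : ℂ) : Set ℂ :=
  {z : ℂ | 0 ≤ z.im ∧ ∃ c ∈ deltaCluster A δ a, dist z c < δ}

/-- Unfolding of membership in a cluster neighbourhood. [folklore] -/
theorem mem_deltaClusterNhd_iff :
    z ∈ deltaClusterNhd A δ a ↔ 0 ≤ z.im ∧ ∃ c ∈ deltaCluster A δ a, dist z c < δ := Iff.rfl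

/-- The cluster neighbourhood as a union of half-balls. [folklore] -/
theorem deltaClusterNhd_eq_biUnion :
    deltaClusterNhd A δ a = ⋃ c ∈ deltaCluster A δ a, (ball c δ ∩ {z : ℂ | 0 ≤ z.im}) := by
  ext z
  simp only [mem_deltaClusterNhd_iff, mem_iUnion, mem_inter_iff, mem_ball, mem_setOf_eq, exists_prop]
  constructor
  · rintro ⟨hz, c, hc, hd⟩
    exact ⟨c, hc, hd, hz⟩
  · rintro ⟨c, hc, hd, hz⟩
    exact ⟨hz, c, hc, hd⟩

/-- The cluster neighbourhood is relatively open in the closed half-plane. [folklore] -/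
theorem exists_isOpen_deltaClusterNhd_eq :
    ∃ U : Set ℂ, IsOpen U ∧ deltaClusterNhd A δ a = U ∩ {z : ℂ | 0 ≤ z.im} := by
  refine ⟨⋃ c ∈ deltaCluster A δ a, ball c δ, isOpen_biUnion fun _ _ ↦ isOpen_ball, ?_⟩
  rw [deltaClusterNhd_eq_biUnion, iUnion₂_inter]

/-- A cluster of points of the closed half-plane lies in its neighbourhood (`δ > 0`). [folklore] -/
theorem deltaCluster_subset_deltaClusterNhd (him : ∀ z ∈ A, 0 ≤ z.im) (ha : a ∈ A) (hδ : 0 < δ) :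
    deltaCluster A δ a ⊆ deltaClusterNhd A δ a :=
  fun c hc ↦ ⟨him c (deltaCluster_subset ha hc), c, hc, by rw [dist_self]; exact hδ⟩

/-- Points of a cluster neighbourhood are within `δ` of `A`. [folklore] -/
theorem infDist_lt_of_mem_deltaClusterNhd (ha : a ∈ A) (hz : z ∈ deltaClusterNhd A δ a) :
    infDist z A < δ := by
  obtain ⟨-, c, hc, hd⟩ := hz
  exact (infDist_le_dist_of_mem (deltaCluster_subset ha hc)).trans_lt hd

/-- **The `δ`-neighbourhood of `A` in the closed half-plane is covered by the cluster
neighbourhoods.** [folklore] -/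
theorem exists_mem_deltaClusterNhd (hne : A.Nonempty) (hz : 0 ≤ z.im)
    (hd : infDist z A < δ) : ∃ a ∈ A, z ∈ deltaClusterNhd A δ a := by
  obtain ⟨a, ha, had⟩ := (Metric.infDist_lt_iff hne).1 hd
  exact ⟨a, ha, hz, a, mem_deltaCluster_self A δ a, had⟩

/-- **The points of `A` in a cluster neighbourhood are the points of the cluster** (a point of `A`
within `δ < 2δ` of the cluster is linked to it). [folklore] -/
theorem deltaClusterNhd_inter_eq (him : ∀ z ∈ A, 0 ≤ z.im) (ha : a ∈ A) (hδ : 0 < δ) :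
    deltaClusterNhd A δ a ∩ A = deltaCluster A δ a := by
  refine Subset.antisymm ?_ fun c hc ↦ ⟨deltaCluster_subset_deltaClusterNhd him ha hδ hc,
    deltaCluster_subset ha hc⟩
  rintro b ⟨⟨-, c, hc, hd⟩, hbA⟩
  refine mem_deltaCluster_of_dist_lt ha hc hbA ?_
  rw [dist_comm]
  linarith

/-- **Cluster neighbourhoods of different clusters are disjoint**: if the neighbourhoods of the
clusters of `a, b ∈ A` meet, the clusters coincide. [folklore] -/
theorem deltaCluster_eq_of_deltaClusterNhd_inter_nonempty (ha : a ∈ A) (hb : b ∈ A)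
    (h : (deltaClusterNhd A δ a ∩ deltaClusterNhd A δ b).Nonempty) :
    deltaCluster A δ a = deltaCluster A δ b := by
  obtain ⟨z, ⟨-, x, hx, hzx⟩, ⟨-, y, hy, hzy⟩⟩ := h
  refine deltaCluster_eq_of_dist_lt ha hb hx hy ?_
  calc dist x y ≤ dist x z + dist z y := dist_triangle _ _ _
    _ < δ + δ := by rw [dist_comm x z]; exact add_lt_add hzx hzy
    _ = 2 * δ := by ring

/-- Disjointness of the neighbourhoods of distinct clusters. [folklore] -/
theorem disjoint_deltaClusterNhd (ha : a ∈ A) (hb : b ∈ A)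
    (hne : deltaCluster A δ a ≠ deltaCluster A δ b) :
    Disjoint (deltaClusterNhd A δ a) (deltaClusterNhd A δ b) :=
  Set.disjoint_iff_inter_eq_empty.2 (not_nonempty_iff_eq_empty.1 fun h ↦
    hne (deltaCluster_eq_of_deltaClusterNhd_inter_nonempty ha hb h))

/-- The neighbourhood depends only on the cluster. [folklore] -/
theorem deltaClusterNhd_eq_of_mem (h : b ∈ deltaCluster A δ a) :
    deltaClusterNhd A δ b = deltaClusterNhd A δ a := by
  simp only [deltaClusterNhd, deltaCluster_eq_of_mem h]

/-- `0` is off every cluster neighbourhood when `A` is at distance `≥ δ` from `0`. [folklore] -/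
theorem zero_notMem_deltaClusterNhd (ha : a ∈ A) (h0 : δ ≤ infDist (0 : ℂ) A) :
    (0 : ℂ) ∉ deltaClusterNhd A δ a :=
  fun h ↦ (infDist_lt_of_mem_deltaClusterNhd ha h).not_ge h0

/-! ### Connectedness of the cluster neighbourhoods -/

/-- The midpoint of a `δ`-step is in both half-balls. [folklore] -/
theorem midpoint_mem_inter {x y : ℂ} (hx : 0 ≤ x.im) (hy : 0 ≤ y.im) (hd : dist x y < 2 * δ) :
    ((x + y) / 2) ∈ (ball x δ ∩ {z : ℂ | 0 ≤ z.im}) ∩ (ball y δ ∩ {z : ℂ | 0 ≤ z.im}) := by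
  have him : 0 ≤ ((x + y) / 2).im := by
    simp only [Complex.div_ofNat_im, Complex.add_im]; positivity
  have h1 : dist ((x + y) / 2) x = dist x y / 2 := by
    rw [dist_eq_norm, dist_eq_norm, show (x + y) / 2 - x = (y - x) / 2 by ring, norm_div,
      Complex.norm_ofNat, norm_sub_rev]
  have h2 : dist ((x + y) / 2) y = dist x y / 2 := by
    rw [dist_eq_norm, dist_eq_norm, show (x + y) / 2 - y = (x - y) / 2 by ring, norm_div,
      Complex.norm_ofNat]
  refine ⟨⟨?_, him⟩, ⟨?_, him⟩⟩
  · rw [mem_ball, h1]; linarith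
  · rw [mem_ball, h2]; linarith

/-- A point slightly above the midpoint of a `δ`-step is in both open half-balls. [folklore] -/
theorem exists_mem_inter_upperHalfPlaneSet {x y : ℂ} (hx : 0 ≤ x.im) (hy : 0 ≤ y.im)
    (hd : dist x y < 2 * δ) :
    ((ball x δ ∩ upperHalfPlaneSet) ∩ (ball y δ ∩ upperHalfPlaneSet)).Nonempty := by
  obtain ⟨⟨hmx, hmim⟩, ⟨hmy, -⟩⟩ := midpoint_mem_inter (δ := δ) hx hy hd
  set m : ℂ := (x + y) / 2 with hm
  rw [mem_ball] at hmx hmy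
  set ε : ℝ := min (δ - dist m x) (δ - dist m y) / 2 with hε
  have hε0 : 0 < ε := by
    rw [hε]; have := lt_min (sub_pos.2 hmx) (sub_pos.2 hmy); positivity
  have hεx : ε < δ - dist m x := by
    rw [hε]; have := min_le_left (δ - dist m x) (δ - dist m y); linarith [sub_pos.2 hmx]
  have hεy : ε < δ - dist m y := by
    rw [hε]; have := min_le_right (δ - dist m x) (δ - dist m y); linarith [sub_pos.2 hmy]
  set p : ℂ := m + (ε : ℂ) * I with hp
  have hpm : dist p m = ε := by
    rw [dist_eq_norm, hp, add_sub_cancel_left, norm_mul, Complex.norm_real, Complex.norm_I, mul_one,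
      Real.norm_of_nonneg hε0.le]
  have hpim : 0 < p.im := by
    have : p.im = m.im + ε := by simp [hp]
    rw [this]; exact add_pos_of_nonneg_of_pos hmim hε0
  refine ⟨p, ⟨?_, hpim⟩, ⟨?_, hpim⟩⟩
  · rw [mem_ball]
    calc dist p x ≤ dist p m + dist m x := dist_triangle _ _ _
      _ < δ := by rw [hpm]; linarith
  · rw [mem_ball]
    calc dist p y ≤ dist p m + dist m y := dist_triangle _ _ _
      _ < δ := by rw [hpm]; linarith

/-- Chains of `δ`-steps from a point of a cluster stay in the cluster and give chains of meeting
half-balls (the relation used by `IsPreconnected.biUnion_of_reflTransGen`). [folklore] -/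
theorem reflTransGen_inter_nonempty {s : ℂ → Set ℂ}
    (hs : ∀ x ∈ A, ∀ y ∈ A, dist x y < 2 * δ → (s x ∩ s y).Nonempty)
    {i j : ℂ} (hi : i ∈ deltaCluster A δ a) (hij : ReflTransGen (deltaStep A δ) i j) :
    ReflTransGen (fun x y ↦ (s x ∩ s y).Nonempty ∧ x ∈ deltaCluster A δ a) i j := by
  induction hij with
  | refl => exact ReflTransGen.refl
  | @tail x y hix hxy ih =>
    have hx : x ∈ deltaCluster A δ a := ReflTransGen.trans hi hix
    exact ReflTransGen.tail ih ⟨hs x hxy.1 y hxy.2.1 hxy.2.2, hx⟩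

/-- **Cluster neighbourhoods are connected** (a chain-linked union of convex half-balls). [folklore] -/
theorem isPreconnected_deltaClusterNhd (him : ∀ z ∈ A, 0 ≤ z.im) :
    IsPreconnected (deltaClusterNhd A δ a) := by
  rw [deltaClusterNhd_eq_biUnion]
  refine IsPreconnected.biUnion_of_reflTransGen (fun c _ ↦ ?_) fun i hi j hj ↦ ?_
  · exact ((convex_ball c δ).inter (convex_halfSpace_im_ge 0)).isPreconnected
  · have hij : ReflTransGen (deltaStep A δ) i j :=
      ReflTransGen.trans (reflTransGen_deltaStep_symm hi) hj
    refine reflTransGen_inter_nonempty (fun x hx y hy hd ↦ ?_) hi hij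
    exact ⟨_, midpoint_mem_inter (him x hx) (him y hy) hd⟩

/-- **The part of a cluster neighbourhood in the open half-plane is connected** as well. [folklore] -/
theorem isPreconnected_deltaClusterNhd_inter (him : ∀ z ∈ A, 0 ≤ z.im) :
    IsPreconnected (deltaClusterNhd A δ a ∩ upperHalfPlaneSet) := by
  have heq : deltaClusterNhd A δ a ∩ upperHalfPlaneSet =
      ⋃ c ∈ deltaCluster A δ a, (ball c δ ∩ upperHalfPlaneSet) := by
    rw [deltaClusterNhd_eq_biUnion, iUnion₂_inter]
    refine iUnion₂_congr fun c _ ↦ ?_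
    ext z
    simp only [mem_inter_iff, mem_setOf_eq]
    constructor
    · rintro ⟨⟨hb, -⟩, hz⟩; exact ⟨hb, hz⟩
    · rintro ⟨hb, hz⟩; exact ⟨⟨hb, le_of_lt (show (0 : ℝ) < z.im from hz)⟩, hz⟩
  rw [heq]
  refine IsPreconnected.biUnion_of_reflTransGen (fun c _ ↦ ?_) fun i hi j hj ↦ ?_
  · exact ((convex_ball c δ).inter (convex_halfSpace_im_gt 0)).isPreconnected
  · have hij : ReflTransGen (deltaStep A δ) i j :=
      ReflTransGen.trans (reflTransGen_deltaStep_symm hi) hj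
    exact reflTransGen_inter_nonempty
      (fun x hx y hy hd ↦ exists_mem_inter_upperHalfPlaneSet (him x hx) (him y hy) hd) hi hij

/-- The part of the cluster neighbourhood of `a ∈ A` in the open half-plane is nonempty (`δ > 0`):
it contains `a + iδ/2`. [folklore] -/
theorem deltaClusterNhd_inter_nonempty (him : ∀ z ∈ A, 0 ≤ z.im) (ha : a ∈ A) (hδ : 0 < δ) :
    (deltaClusterNhd A δ a ∩ upperHalfPlaneSet).Nonempty := by
  set p : ℂ := a + ((δ / 2 : ℝ) : ℂ) * I with hp
  have hpa : dist p a = δ / 2 := by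
    rw [dist_eq_norm, hp, add_sub_cancel_left, norm_mul, Complex.norm_real, Complex.norm_I, mul_one,
      Real.norm_of_nonneg (by positivity)]
  have hpim : p.im = a.im + δ / 2 := by simp [hp]
  have hpos : 0 < p.im := by rw [hpim]; linarith [him a ha]
  exact ⟨p, ⟨hpos.le, a, mem_deltaCluster_self A δ a, by rw [hpa]; linarith⟩, hpos⟩

end Literature.Probability.RandomPlanarGeometry

end
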